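import Summits.RiemannHypothesis.RiemannHypothesis.Theorems.GroundBartaEvenWinsBeyondArchDeflationWindowGlue
import Literature.NumberTheory.LFunctions.WeilArchDensityTail
import Literature.NumberTheory.LFunctions.WeilArchDensityPanelTM
import Literature.NumberTheory.LFunctions.WeilMarkovTwoPrime
import Literature.NumberTheory.LFunctions.WeilMarkovThreePrime
import Literature.Analysis.ValidatedNumerics.IntervalLogArctan
import Literature.NumberTheory.LFunctions.WeilTwoPrimeCellsMP
import HarnessLib

/-!
# RiemannHypothesis / GroundBarta — rung 4 (`EvenWinsBeyondArch`, stmt-RiemannHypothesis-18807 / 18085):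
# the deflated Temple L-side, XIX c — the window constants: kernel enclosures and the prime slots

Helper file (`--supports stmt-RiemannHypothesis-18807`), RH-free, Mathlib + landed tree files only, no facts.  Prover B,
speedrun unit `sr-gb-rung-b` (gen 4).

The window-level constants of the R-layer certificate, each a kernel-computable `Option MI` with a soundness theorem
(`= some Y ⇒ Y ∋ value`), built from the tree's multiprecision interval kernel (`MI.expPt`, `MI.logNat`, `MI.pi`, `MI.logPos`,
`MI.arctan`, `MI.divPos`):
* `dt_mem_expHalf` / `dt_mem_expNegHalf` — `e^{±y/2}` (`expRatMI`);
* `dt_C0` — `log 2 + π/4`;  `dt_PsiFar` — `Ψ(2c) = ½ log((1+e^{-c})/(1−e^{-c})) + arctan e^{-c}` (`weilArchTail_eq`);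
* `dt_logRat` — `log q` of a positive rational (for `ℓ = log(2h)`), `dt_log_twoH_bounds`;
* the prime slots of the `{2,3}`- and `{2,3,4}`-windows: `dt_IwSqrt` (`log p/√p = log p · e^{-(log p)/2}`), `dt_IwHalf` (`log 2/2`),
  `MI.logNat` for `L_j = log n`, the certified window-range tests `dt_twoWindowCheck` / `dt_threeWindowCheck`, and the three-slot
  form of the prime sum `dt_hprimes_two` / `dt_hprimes_three` (from `sum_weilPrimeIndex_eq_twoPrime` / `…threePrime`).

References: E. Bombieri, Rend. Mat. Acc. Lincei (9) 11 (2000) Thm 2 [Bombieri2000Weil].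
-/

set_option linter.dupNamespace false

noncomputable section

open MeasureTheory Set Filter Finset
open scoped Topology BigOperators

namespace Summit.RiemannHypothesis.RiemannHypothesis.Theorems.EvenWinsBeyondArch

open Literature.NumberTheory.LFunctions
open Literature.Analysis.ValidatedNumerics Literature.Analysis.ValidatedNumerics.PolyMP
  Literature.Analysis.ValidatedNumerics.NumericsMP Literature.Analysis.ValidatedNumerics.ExpPoly

/-! ## `e^{±y/2}` -/

/-- `e^{y₀/2} ∈ expRatMI … (y₀/2)` in the form the panel rules want. -/
theorem dt_mem_expHalf {S : ℕ} (hS : 0 < S) {Ke ke : ℕ} {y0 : ℚ}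
    (h : (MI.expPt S Ke ke (ofRat S (y0 / 2))).isSome = true) :
    MI.mem S (Real.exp ((y0 : ℝ) / 2)) (expRatMI S Ke ke (y0 / 2)) := by
  have := mem_expRatMI hS h
  push_cast at this
  exact this

/-- `e^{-y₀/2} ∈ expRatMI … (−(y₀/2))`. -/
theorem dt_mem_expNegHalf {S : ℕ} (hS : 0 < S) {Ke ke : ℕ} {y0 : ℚ}
    (h : (MI.expPt S Ke ke (ofRat S (-(y0 / 2)))).isSome = true) :
    MI.mem S (Real.exp (-((y0 : ℝ) / 2))) (expRatMI S Ke ke (-(y0 / 2))) := by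
  have := mem_expRatMI hS h
  push_cast at this
  exact this

/-! ## `log 2 + π/4` and `Ψ(2c)` -/

/-- Kernel enclosure of `log 2 + π/4` (`K` series terms). -/
def dt_C0 (S K : ℕ) : Option MI :=
  (MI.logNat S K 2).bind fun l ↦ (MI.pi S K).bind fun p ↦ some (MI.add l (MI.divNat p 4))

/-- Soundness of `dt_C0`. -/
theorem dt_mem_C0 {S : ℕ} (hS : 0 < S) {K : ℕ} {Y : MI} (h : dt_C0 S K = some Y) :
    MI.mem S (Real.log 2 + Real.pi / 4) Y := by
  simp only [dt_C0, Option.bind_eq_some_iff, Option.some.injEq] at h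
  obtain ⟨l, hl, p, hp, h⟩ := h
  rw [← h]
  have h1 := MI.mem_logNat hS hl
  have h2 := MI.mem_divNat (MI.mem_pi S hp) (n := 4) (by norm_num)
  push_cast at h1 h2
  exact MI.mem_add h1 h2

/-- Kernel enclosure of `Ψ(2c) = ½ log((1+e^{-c})/(1−e^{-c})) + arctan(e^{-c})` (`K` series terms, `Ke`/`ke` for the exponential). -/
def dt_PsiFar (S K Ke ke : ℕ) (c : ℚ) : Option MI :=
  (MI.expPt S Ke ke (ofRat S (-c))).bind fun E ↦
    (MI.divPos S (MI.add (MI.ofInt S 1) E) (MI.sub (MI.ofInt S 1) E)).bind fun R ↦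
      (MI.logPos S K R).bind fun Lg ↦ (MI.pi S K).bind fun P ↦ (MI.arctan S K P E).bind fun A ↦
        some (MI.add (MI.divNat Lg 2) A)

/-- Soundness of `dt_PsiFar`: for `0 < c`, `dt_PsiFar … c = some Y ⇒ Y ∋ Ψ(2c)`. [cite: Bombieri2000Weil, Thm 2 (archimedean density)] -/
theorem dt_mem_PsiFar {S : ℕ} (hS : 0 < S) {K Ke ke : ℕ} {c : ℚ} (hc : 0 < c) {Y : MI}
    (h : dt_PsiFar S K Ke ke c = some Y) : MI.mem S (weilArchTail (2 * (c : ℝ))) Y := by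
  simp only [dt_PsiFar, Option.bind_eq_some_iff, Option.some.injEq] at h
  obtain ⟨E, hE, R, hR, Lg, hL, P, hP, A, hA, h⟩ := h
  rw [← h]
  have hcr : (0 : ℝ) < 2 * (c : ℝ) := by
    have : (0 : ℝ) < c := by exact_mod_cast hc
    linarith
  rw [weilArchTail_eq hcr, weilArchTailClosed]
  have ee : Real.exp (-(2 * (c : ℝ) / 2)) = Real.exp (((-c : ℚ) : ℝ)) := by push_cast; ring_nf
  rw [ee]
  have hEm : MI.mem S (Real.exp (((-c : ℚ) : ℝ))) E := MI.mem_expPt hS hE (mem_ofRat S (-c))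
  have h1 : MI.mem S (1 : ℝ) (MI.ofInt S 1) := by exact_mod_cast MI.mem_ofInt S 1
  have hRm := MI.mem_divPos hS hR (MI.mem_add h1 hEm) (MI.mem_sub h1 hEm)
  have hLm := (MI.mem_logPos hS hL hRm).2
  have hAm := MI.mem_arctan hS (MI.mem_pi S hP) hA hEm
  have hhalf := MI.mem_divNat hLm (n := 2) (by norm_num)
  have e2 : Real.log ((1 + Real.exp (((-c : ℚ) : ℝ))) / (1 - Real.exp (((-c : ℚ) : ℝ)))) / ((2 : ℕ) : ℝ) =
      (1 / 2) * Real.log ((1 + Real.exp (((-c : ℚ) : ℝ))) / (1 - Real.exp (((-c : ℚ) : ℝ)))) := by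
    push_cast; ring
  rw [e2] at hhalf
  exact MI.mem_add hhalf hAm

/-! ## `log` of a positive rational: `ℓ = log(2h)` -/

/-- Kernel enclosure of `log q`, `q` a positive rational. -/
def dt_logRat (S K : ℕ) (q : ℚ) : Option MI := MI.logPos S K (ofRat S q)

/-- Soundness of `dt_logRat`. -/
theorem dt_mem_logRat {S : ℕ} (hS : 0 < S) {K : ℕ} {q : ℚ} {Y : MI} (h : dt_logRat S K q = some Y) :
    MI.mem S (Real.log q) Y :=
  (MI.mem_logPos hS h (mem_ofRat S q)).2

/-- The rational bracket of `log(2h)`, `h = c/(2m)`, read off `dt_logRat S K (c/m) = some Y`. -/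
theorem dt_log_twoH_bounds {S : ℕ} (hS : 0 < S) {K : ℕ} {c : ℚ} {m : ℕ} (hm : 0 < m) {Y : MI}
    (h : dt_logRat S K (c / m) = some Y) :
    (((Y.lo : ℚ) / S : ℚ) : ℝ) ≤ Real.log (2 * ((c / (2 * m) : ℚ) : ℝ)) ∧
      Real.log (2 * ((c / (2 * m) : ℚ) : ℝ)) ≤ (((Y.hi : ℚ) / S : ℚ) : ℝ) := by
  have hm' : (m : ℝ) ≠ 0 := by exact_mod_cast hm.ne'
  have e : 2 * ((c / (2 * m) : ℚ) : ℝ) = ((c / m : ℚ) : ℝ) := by push_cast; field_simp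
  rw [e]
  exact MI_mem_bounds hS (dt_mem_logRat hS h)

/-! ## The prime slots -/

/-- Kernel enclosure of `log p · e^{-(log p)/2} = log p/√p` (`K` log terms, `K'`/`k'` exp parameters). -/
def dt_IwSqrt (S K K' k' : ℕ) (p : ℕ) : Option MI :=
  (MI.logNat S K p).bind fun l ↦ (MI.exp S K' k' (MI.neg (MI.divNat l 2))).bind fun e ↦ some (MI.mul S l e)

/-- `log p/√p = log p · e^{-(log p)/2}` for `0 < p`. -/
theorem dt_log_div_sqrt_eq {p : ℝ} (hp : 0 < p) :
    Real.log p / Real.sqrt p = Real.log p * Real.exp (-(Real.log p / 2)) := by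
  rw [Real.sqrt_eq_rpow, Real.rpow_def_of_pos hp, Real.exp_neg, div_eq_mul_inv]
  congr 2
  ring

/-- Soundness of `dt_IwSqrt`. -/
theorem dt_mem_IwSqrt {S : ℕ} (hS : 0 < S) {K K' k' p : ℕ} (hp : 0 < p) {Y : MI} (h : dt_IwSqrt S K K' k' p = some Y) :
    MI.mem S (Real.log p / Real.sqrt p) Y := by
  simp only [dt_IwSqrt, Option.bind_eq_some_iff, Option.some.injEq] at h
  obtain ⟨l, hl, e, he, h⟩ := h
  rw [← h, dt_log_div_sqrt_eq (by exact_mod_cast hp : (0 : ℝ) < p)]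
  have h1 := MI.mem_logNat hS hl
  have h2 : MI.mem S (-(Real.log p / 2)) (MI.neg (MI.divNat l 2)) := by
    have := MI.mem_neg (MI.mem_divNat h1 (n := 2) (by norm_num))
    push_cast at this
    exact this
  exact MI.mem_mul hS h1 (MI.mem_exp hS he h2)

/-- Kernel enclosure of `log 2/2` (the weight of the prime power `4`). -/
def dt_IwHalf (S K : ℕ) : Option MI := (MI.logNat S K 2).bind fun l ↦ some (MI.divNat l 2)

/-- Soundness of `dt_IwHalf`. -/
theorem dt_mem_IwHalf {S : ℕ} (hS : 0 < S) {K : ℕ} {Y : MI} (h : dt_IwHalf S K = some Y) :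
    MI.mem S (Real.log 2 / 2) Y := by
  simp only [dt_IwHalf, Option.bind_eq_some_iff, Option.some.injEq] at h
  obtain ⟨l, hl, h⟩ := h
  rw [← h]
  have := MI.mem_divNat (MI.mem_logNat hS hl) (n := 2) (by norm_num)
  push_cast at this
  exact this

/-- `MI.logNat` in the cast form `log (n : ℝ)` with a numeral. -/
theorem dt_mem_logNat {S : ℕ} (hS : 0 < S) {K n : ℕ} {Y : MI} (h : MI.logNat S K n = some Y) :
    MI.mem S (Real.log n) Y := MI.mem_logNat hS h

/-! ## Certified window ranges and the three-slot form of the prime sum -/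

/-- `log 3/2 < c ≤ log 2`, certified from the kernel enclosures of `log 2`, `log 3`. -/
def dt_twoWindowCheck (S K : ℕ) (c : ℚ) : Bool :=
  match MI.logNat S K 2, MI.logNat S K 3 with
  | some A, some B => decide ((B.hi : ℚ) < 2 * c * S) && decide ((c : ℚ) * S ≤ A.lo)
  | _, _ => false

/-- Soundness of `dt_twoWindowCheck`. -/
theorem dt_twoWindow_sound {S : ℕ} (hS : 0 < S) {K : ℕ} {c : ℚ} (h : dt_twoWindowCheck S K c = true) :
    Real.log 3 / 2 < (c : ℝ) ∧ (c : ℝ) ≤ Real.log 2 := by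
  unfold dt_twoWindowCheck at h
  cases hA : MI.logNat S K 2 with
  | none => simp [hA] at h
  | some A =>
    cases hB : MI.logNat S K 3 with
    | none => simp [hA, hB] at h
    | some B =>
      simp only [hA, hB, Bool.and_eq_true, decide_eq_true_eq] at h
      have hSr : (0 : ℝ) < S := by exact_mod_cast hS
      obtain ⟨h2lo, _⟩ := MI.mem_logNat hS hA
      obtain ⟨_, h3hi⟩ := MI.mem_logNat hS hB
      have e1 : ((B.hi : ℚ) : ℝ) < 2 * c * S := by exact_mod_cast h.1
      have e2 : (c : ℝ) * S ≤ ((A.lo : ℚ) : ℝ) := by exact_mod_cast h.2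
      push_cast at e1 e2 h2lo h3hi
      constructor
      · have : Real.log 3 * S < 2 * c * S := by linarith
        have := lt_of_mul_lt_mul_right this hSr.le
        linarith
      · exact le_of_mul_le_mul_right (by linarith) hSr

/-- `log 2 < c ≤ log 5/2`, certified from the kernel enclosures of `log 2`, `log 5`. -/
def dt_threeWindowCheck (S K : ℕ) (c : ℚ) : Bool :=
  match MI.logNat S K 2, MI.logNat S K 5 with
  | some A, some B => decide ((A.hi : ℚ) < c * S) && decide (2 * (c : ℚ) * S ≤ B.lo)
  | _, _ => false

/-- Soundness of `dt_threeWindowCheck`. -/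
theorem dt_threeWindow_sound {S : ℕ} (hS : 0 < S) {K : ℕ} {c : ℚ} (h : dt_threeWindowCheck S K c = true) :
    Real.log 2 < (c : ℝ) ∧ (c : ℝ) ≤ Real.log 5 / 2 := by
  unfold dt_threeWindowCheck at h
  cases hA : MI.logNat S K 2 with
  | none => simp [hA] at h
  | some A =>
    cases hB : MI.logNat S K 5 with
    | none => simp [hA, hB] at h
    | some B =>
      simp only [hA, hB, Bool.and_eq_true, decide_eq_true_eq] at h
      have hSr : (0 : ℝ) < S := by exact_mod_cast hS
      obtain ⟨_, h2hi⟩ := MI.mem_logNat hS hA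
      obtain ⟨h5lo, _⟩ := MI.mem_logNat hS hB
      have e1 : ((A.hi : ℚ) : ℝ) < c * S := by exact_mod_cast h.1
      have e2 : 2 * (c : ℝ) * S ≤ ((B.lo : ℚ) : ℝ) := by exact_mod_cast h.2
      push_cast at e1 e2 h2hi h5lo
      constructor
      · exact lt_of_mul_lt_mul_right (by linarith) hSr.le
      · have : 2 * (c : ℝ) * S ≤ Real.log 5 * S := by linarith
        have := le_of_mul_le_mul_right this hSr
        linarith

/-- **Three-slot form of the prime sum on a `{2,3}`-window** (`log 3/2 < c ≤ log 2`): slots `(log 2/√2, log 2)`,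
`(log 3/√3, log 3)`, and an idle third slot of weight `0` (length `log 2`). [cite: Bombieri2000Weil, Thm 2 (prime term)] -/
theorem dt_hprimes_two {c : ℝ} (hb : Real.log 3 / 2 < c) (hb2 : c ≤ Real.log 2) (g G : ℝ → ℝ) (y : ℝ) :
    ∑ n ∈ weilPrimeIndex c, ((ArithmeticFunction.vonMangoldt n : ℝ) / Real.sqrt n) *
        (2 * g y - G (y - Real.log n) - G (y + Real.log n)) =
      Real.log 2 / Real.sqrt 2 * (2 * g y - G (y - Real.log 2) - G (y + Real.log 2)) +
        Real.log 3 / Real.sqrt 3 * (2 * g y - G (y - Real.log 3) - G (y + Real.log 3)) +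
        0 * (2 * g y - G (y - Real.log 2) - G (y + Real.log 2)) := by
  rw [sum_weilPrimeIndex_eq_twoPrime hb hb2]
  push_cast
  ring

/-- **Three-slot form of the prime sum on a `{2,3,4}`-window** (`log 2 < c ≤ log 5/2`): slots `(log 2/√2, log 2)`,
`(log 3/√3, log 3)`, `(log 2/2, log 4)`. [cite: Bombieri2000Weil, Thm 2 (prime term)] -/
theorem dt_hprimes_three {c : ℝ} (hb : Real.log 2 < c) (hb2 : c ≤ Real.log 5 / 2) (g G : ℝ → ℝ) (y : ℝ) :
    ∑ n ∈ weilPrimeIndex c, ((ArithmeticFunction.vonMangoldt n : ℝ) / Real.sqrt n) *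
        (2 * g y - G (y - Real.log n) - G (y + Real.log n)) =
      Real.log 2 / Real.sqrt 2 * (2 * g y - G (y - Real.log 2) - G (y + Real.log 2)) +
        Real.log 3 / Real.sqrt 3 * (2 * g y - G (y - Real.log 3) - G (y + Real.log 3)) +
        Real.log 2 / 2 * (2 * g y - G (y - Real.log 4) - G (y + Real.log 4)) := by
  rw [sum_weilPrimeIndex_eq_threePrime hb hb2]
  push_cast
  ring

end Summit.RiemannHypothesis.RiemannHypothesis.Theorems.EvenWinsBeyondArch

end
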